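import Summits.CriticalPhenomena.PercolationContinuityZ3.Theorems.Transplant.SkelFrmQuasi1ParamsPO
import Summits.CriticalPhenomena.PercolationContinuityZ3.Theorems.Transplant.SkelFrm1ParamsPO
import Summits.CriticalPhenomena.PercolationContinuityZ3.Theorems.Transplant.SkelNeg1ParamsO
import Summits.CriticalPhenomena.PercolationContinuityZ3.Theorems.Transplant.SkelPhiRunKitClause
import Summits.CriticalPhenomena.PercolationContinuityZ3.Theorems.Transplant.SkelNegBParamsKitS
import Summits.CriticalPhenomena.PercolationContinuityZ3.Theorems.Transplant.PlanarSkeletonFrmQuasiDefs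
import Summits.CriticalPhenomena.PercolationContinuityZ3.Theorems.Transplant.PlanarSkeletonFrmDefs
import Summits.CriticalPhenomena.PercolationContinuityZ3.Theorems.Transplant.SkelPhiStepIDataNS
import Summits.CriticalPhenomena.PercolationContinuityZ3.Theorems.Transplant.SkelFrmFromBParamsKitS
import HarnessLib
import Summits.CriticalPhenomena.PercolationContinuityZ3.Theorems.Transplant.SkelFrmBParamsKitS
/-!
# GEN-Q PORT (WAVE-Q GEN-Q table v0.9, row G011, U-level L2; captain R-6/R-7 2026-08-27: carrier token swap `PlanarSkeletonFrmFrom ↦ PlanarSkeletonFrmQuasi`)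
# of the tree module «Transplant/SkelFrmFromBParamsKitS» (sha256 9e5ad97871ba4e0b…) onto the quasi-step carrier `PlanarSkeletonFrmQuasi` (p507026): «SkelFrmQuasiBParamsKitS»

ORIGINAL TITLE: N2 (frames-only node `SamePDropOfSkeletonFrm₁`, OPEN) params column over `PlanarSkeletonFrm` — (ζ″) ledger, shape (B′) of record ((R-14)):

builds on p205010 (kernel theorem, internal audit signed; external expert review pending) — nothing in this file uses p205010; NOTHING is claimed about any open node
((N3-b), the end state).  Lane `prim-bschramm`, seat `prim-hp-8` (gen 62; GEN-Q pen, family BChoiceRoot*/1Root*/BParamsRoot·Kit·Bridge; tool = captain gen-1 g4's port_genq.py).  Helper file (`--supports stmt-CriticalPhenomena-4575 --as helper`).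
PORT RULES (U-wave r1–r4 re-used, GEN-Q hunk classes of p3-g29 #6136): declaration order, names and proof texts are those of «SkelFrmFromBParamsKitS», byte-identical except
(i) the carrier token `PlanarSkeletonFrmFrom ↦ PlanarSkeletonFrmQuasi` in binders, `namespace`/`end` lines and qualified names (module names `SkelFrmFrom… ↦ SkelFrmQuasi…`
in imports of already-ported rows); (ii) `Φ.step ↦ Φ.qstep` with the called Steps lemma replaced by its `…Q`/`_q` twin and the cost `Φ.M` threaded (none in this file unless
listed below); (iii) `Φ.cyl_connected ↦ Φ.cyl_reach` readers (none unless listed); (iv) graph-ball radii / window floors ×`Φ.M` (none unless listed).  Carrier-free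
residents stay imported/exported from the original «SkelFrmBParamsKitS» exactly as in the FrmFrom port.  Docstrings and citations are the original's.

-/

noncomputable section

open scoped Classical

namespace Summit.CriticalPhenomena.PercolationContinuityZ3.Theorems.Transplant

namespace PlanarSkeletonFrmQuasi

namespace NegB

namespace KS

open Literature.Probability.Percolation Literature.Probability.LatticeModels SimpleGraph
open Literature.Barriers.CriticalPhenomena (graphBall)
open SkelConc (Consts)
open BoxProdZ2 (kitK kitN kitL)
open SkelI (tanOff)
open Skelφ.StepI (DataN)
open Neg

/-! ## §1 The kit-link pair and its data (read off `D` alone) -/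

section Data

export PlanarSkeletonFrmFrom.NegB.KS (MK)

export PlanarSkeletonFrmFrom.NegB.KS (nKit)

export PlanarSkeletonFrmFrom.NegB.KS (hKit)

export PlanarSkeletonFrmFrom.NegB.KS (ℓKit)

export PlanarSkeletonFrmFrom.NegB.KS (vKit)

export PlanarSkeletonFrmFrom.NegB.KS (RK)

export PlanarSkeletonFrmFrom.NegB.KS (Rs)

export PlanarSkeletonFrmFrom.NegB.KS (MK_facts)

export PlanarSkeletonFrmFrom.NegB.KS (nKit_facts)

export PlanarSkeletonFrmFrom.NegB.KS (kit_pair_eq)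

export PlanarSkeletonFrmFrom.NegB.KS (kit_adm)

export PlanarSkeletonFrmFrom.NegB.KS (RK_le_Rs)

export PlanarSkeletonFrmFrom.NegB.KS (RK_eq)

/-! ## §2 The apron integers (pure arithmetic in `Rs`, `M_u`) -/

export PlanarSkeletonFrmFrom.NegB.KS (Wa)

export PlanarSkeletonFrmFrom.NegB.KS (da)

export PlanarSkeletonFrmFrom.NegB.KS (ℓsa)

export PlanarSkeletonFrmFrom.NegB.KS (Dsh)

export PlanarSkeletonFrmFrom.NegB.KS (Kmax)

export PlanarSkeletonFrmFrom.NegB.KS (KCmax)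

export PlanarSkeletonFrmFrom.NegB.KS (Ma)

export PlanarSkeletonFrmFrom.NegB.KS (T₀a)

export PlanarSkeletonFrmFrom.NegB.KS (Dsh_eq)

export PlanarSkeletonFrmFrom.NegB.KS (T₀a_eq)

export PlanarSkeletonFrmFrom.NegB.KS (hd1_at)

export PlanarSkeletonFrmFrom.NegB.KS (hD1_at)

export PlanarSkeletonFrmFrom.NegB.KS (hD2_at)

export PlanarSkeletonFrmFrom.NegB.KS (hDρ_at)

export PlanarSkeletonFrmFrom.NegB.KS (hW_at)

export PlanarSkeletonFrmFrom.NegB.KS (hKmax_at)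

export PlanarSkeletonFrmFrom.NegB.KS (hKCmax_at)

export PlanarSkeletonFrmFrom.NegB.KS (hKmax_one)

export PlanarSkeletonFrmFrom.NegB.KS (hT_at)

export PlanarSkeletonFrmFrom.NegB.KS (le_T₀a)

end Data

/-! ## §3 The constants that read the skeleton (degree bound, comparison radii) -/

section Skel

/-- **The fat-prism radius of the apron** `R'_P := cylRadMax G φ types 1 (Rs + KCmax + (W + Kmax))` (p3-g9 14:57:15Z (ii): the apron capture radius). [this work] -/
def RPa {V : Type} {G : SimpleGraph V} [G.LocallyFinite] (Φ : PlanarSkeletonFrmQuasi G) (t : V) (D : Skelφ.StepI.DataNS V) (mk : ℕ) : ℕ := Skelφ.cylRadMax G Φ.φ Φ.types 1 (Rs t D mk + KCmax t D mk + (Wa t D mk + Kmax t D mk))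

export PlanarSkeletonFrmFrom.NegB.KS (reachA)

/-- The near/far base `base := 13·(T₀+2) + 13·d + (W + Kmax + R'_P) + (KCmax + Rs)` (`r₀ ≥ base`). [this work] -/
def baseA {V : Type} {G : SimpleGraph V} [G.LocallyFinite] (Φ : PlanarSkeletonFrmQuasi G) (t : V) (D : Skelφ.StepI.DataNS V) (mk : ℕ) : ℕ := 13 * (T₀a t D mk + 2) + 13 * da t D mk + (Wa t D mk + Kmax t D mk + RPa Φ t D mk) + (KCmax t D mk + Rs t D mk)

/-- The shell radius `rs := 2·(1 + base)`. [this work] -/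
def rsA {V : Type} {G : SimpleGraph V} [G.LocallyFinite] (Φ : PlanarSkeletonFrmQuasi G) (t : V) (D : Skelφ.StepI.DataNS V) (mk : ℕ) : ℕ := 2 * (1 + baseA Φ t D mk)

/-- The Step-III region-size bound `cS := 14·(T₀+1) + 14·d + (2W+1)(Kmax+1)(Δ+1)^{R'_P}`. [this work] -/
def cSA {V : Type} {G : SimpleGraph V} [G.LocallyFinite] (Φ : PlanarSkeletonFrmQuasi G) (t : V) (D : Skelφ.StepI.DataNS V) (mk : ℕ) : ℕ := 14 * (T₀a t D mk + 1) + 14 * da t D mk + (2 * Wa t D mk + 1) * (Kmax t D mk + 1) * (Φ.Δ + 1) ^ RPa Φ t D mk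

/-- The short-region card bound `cU := (Δ+1)^{RK}`. [this work] -/
def cUA {V : Type} {G : SimpleGraph V} [G.LocallyFinite] (Φ : PlanarSkeletonFrmQuasi G) (t : V) (D : Skelφ.StepI.DataNS V) (mk : ℕ) : ℕ := (Φ.Δ + 1) ^ RK t D mk

/-- The Step-III seed-size bound `sB := 1 + Δ·cS + cS·cU`. [this work] -/
def sBA {V : Type} {G : SimpleGraph V} [G.LocallyFinite] (Φ : PlanarSkeletonFrmQuasi G) (t : V) (D : Skelφ.StepI.DataNS V) (mk : ℕ) : ℕ := 1 + Φ.Δ * cSA Φ t D mk + cSA Φ t D mk * cUA Φ t D mk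

/-- The contact multiplier `B := (Δ+1)^{2·rs}`. [this work] -/
def BA {V : Type} {G : SimpleGraph V} [G.LocallyFinite] (Φ : PlanarSkeletonFrmQuasi G) (t : V) (D : Skelφ.StepI.DataNS V) (mk : ℕ) : ℕ := (Φ.Δ + 1) ^ (2 * rsA Φ t D mk)

-- GEN-Q (R-2, captain 2026-08-27): `PlanarSkeletonFrmFrom.NegB.KS.hR'_at` is not in the used cone of the node top — not ported.

/-- `1 ≤ cU`. [folklore] -/
theorem hcU1_at {V : Type} {G : SimpleGraph V} [G.LocallyFinite] (Φ : PlanarSkeletonFrmQuasi G) (t : V) (D : Skelφ.StepI.DataNS V) (mk : ℕ) : 1 ≤ cUA Φ t D mk := Nat.one_le_pow _ _ (Nat.succ_pos _)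

-- GEN-Q (R-2, captain 2026-08-27): `PlanarSkeletonFrmFrom.NegB.KS.apron` is not in the used cone of the node top — not ported.

-- GEN-Q (R-2, captain 2026-08-27): `PlanarSkeletonFrmFrom.NegB.KS.apron_fields` is not in the used cone of the node top — not ported.

-- GEN-Q (R-2, captain 2026-08-27): `PlanarSkeletonFrmFrom.NegB.KS.shellD_apron` is not in the used cone of the node top — not ported.

-- GEN-Q (R-2, captain 2026-08-27): `PlanarSkeletonFrmFrom.NegB.KS.tanOff_apron` is not in the used cone of the node top — not ported.

-- GEN-Q (R-2, captain 2026-08-27): `PlanarSkeletonFrmFrom.NegB.KS.apron_ok` is not in the used cone of the node top — not ported.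

-- GEN-Q (R-2, captain 2026-08-27): `PlanarSkeletonFrmFrom.NegB.KS.apron_sizes` is not in the used cone of the node top — not ported.

-- GEN-Q (R-2, captain 2026-08-27): `PlanarSkeletonFrmFrom.NegB.KS.hr₀_apron` is not in the used cone of the node top — not ported.

-- GEN-Q (R-2, captain 2026-08-27): `PlanarSkeletonFrmFrom.NegB.KS.hreach_apron` is not in the used cone of the node top — not ported.

export PlanarSkeletonFrmFrom.NegB.KS (RgK)

export PlanarSkeletonFrmFrom.NegB.KS (RgK_subset_graphBall)

-- GEN-Q (R-2, captain 2026-08-27): `PlanarSkeletonFrmFrom.NegB.KS.card_RgK_le` is not in the used cone of the node top — not ported.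

export PlanarSkeletonFrmFrom.NegB.KS (QK)

export PlanarSkeletonFrmFrom.NegB.KS (QK_facts)

export PlanarSkeletonFrmFrom.NegB.KS (j₀A)

export PlanarSkeletonFrmFrom.NegB.KS (levels_wide)

-- GEN-Q (R-2, captain 2026-08-27): `PlanarSkeletonFrmFrom.NegB.KS.r₀A` is not in the used cone of the node top — not ported.

-- GEN-Q (R-2, captain 2026-08-27): `PlanarSkeletonFrmFrom.NegB.KS.r₀A_ge` is not in the used cone of the node top — not ported.

end Skel

/-! ## §4 The counts, the levels, `Rlev` and `R′` -/

section Counts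

-- GEN-Q (R-2, captain 2026-08-27): `PlanarSkeletonFrmFrom.NegB.KS.kkA` is not in the used cone of the node top — not ported.

-- GEN-Q (R-2, captain 2026-08-27): `PlanarSkeletonFrmFrom.NegB.KS.NkA` is not in the used cone of the node top — not ported.

/-- **The number of levels** `Lcnt := kitL Δ sB B δkit p` (`≥ 1`). [this work] -/
def LcntA (κ : Consts) {V : Type} [Countable V] {G : SimpleGraph V} [G.LocallyFinite] (Φ : PlanarSkeletonFrmQuasi G) (t : V) (p : unitInterval) (D : Skelφ.StepI.DataNS V) (mk : ℕ) : ℕ := kitL Φ.Δ (sBA Φ t D mk) (BA Φ t D mk) (Neg.δkit κ Φ) p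

/-- **The last kit level** `j₁ := T₀ + Lcnt − 1` (`card [j₀, j₁] = Lcnt`). [this work] -/
def j₁A (κ : Consts) {V : Type} [Countable V] {G : SimpleGraph V} [G.LocallyFinite] (Φ : PlanarSkeletonFrmQuasi G) (t : V) (p : unitInterval) (D : Skelφ.StepI.DataNS V) (mk : ℕ) : ℕ := T₀a t D mk + LcntA κ Φ t p D mk - 1

/-- **THE WINDOW DEPTH IN LEVELS OF RECORD** `Rlev := j₁ + reach` (levels + the kit reach beyond the level). [this work] -/
def RlevA (κ : Consts) {V : Type} [Countable V] {G : SimpleGraph V} [G.LocallyFinite] (Φ : PlanarSkeletonFrmQuasi G) (t : V) (p : unitInterval) (D : Skelφ.StepI.DataNS V) (mk : ℕ) : ℕ := j₁A κ Φ t p D mk + reachA t D mk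

/-- **THE KIT-LEVEL DISPLACEMENT OF RECORD** `R′ := Rlev + 1` — the ledger's `R′` (v0.11): run enlargement `S.R′`, (C)'s `e − z`, the bridge clearance `Δ₀ = k + 2R′ + 1`,
the cell floors `s_i ≥ c·R′ + …` (through the box slot `g ∋ 4K(R′+2)`). [cite: KozmaNitzan2024, §4 Theorem 6 (pp. 25–31)] -/
def RA' (κ : Consts) {V : Type} [Countable V] {G : SimpleGraph V} [G.LocallyFinite] (Φ : PlanarSkeletonFrmQuasi G) (t : V) (p : unitInterval) (D : Skelφ.StepI.DataNS V) (mk : ℕ) : ℕ := RlevA κ Φ t p D mk + 1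

-- GEN-Q (R-2, captain 2026-08-27): `PlanarSkeletonFrmFrom.NegB.KS.LcntA_pos` is not in the used cone of the node top — not ported.

-- GEN-Q (R-2, captain 2026-08-27): `PlanarSkeletonFrmFrom.NegB.KS.card_levels` is not in the used cone of the node top — not ported.

-- GEN-Q (R-2, captain 2026-08-27): `PlanarSkeletonFrmFrom.NegB.KS.j₀A_le_j₁A` is not in the used cone of the node top — not ported.

-- GEN-Q (R-2, captain 2026-08-27): `PlanarSkeletonFrmFrom.NegB.KS.hNk_at` is not in the used cone of the node top — not ported.

-- GEN-Q (R-2, captain 2026-08-27): `PlanarSkeletonFrmFrom.NegB.KS.counts_atq` is not in the used cone of the node top — not ported.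

-- GEN-Q (R-2, captain 2026-08-27): `PlanarSkeletonFrmFrom.NegB.KS.j_reach_le` is not in the used cone of the node top — not ported.

/-- `R′ = j₁ + reach + 1`, `Rlev + 1 = R′`, `j₁ ≤ Rlev`, `T₀ ≤ j₁` (under `0 < p < 1` for the last). [folklore] -/
theorem RA'_eq (κ : Consts) {V : Type} [Countable V] {G : SimpleGraph V} [G.LocallyFinite] (Φ : PlanarSkeletonFrmQuasi G) (t : V) (p : unitInterval) (D : Skelφ.StepI.DataNS V) (mk : ℕ) : RA' κ Φ t p D mk = j₁A κ Φ t p D mk + reachA t D mk + 1 ∧ RlevA κ Φ t p D mk + 1 = RA' κ Φ t p D mk ∧ j₁A κ Φ t p D mk ≤ RlevA κ Φ t p D mk :=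
  ⟨rfl, rfl, Nat.le_add_right _ _⟩

/-- `T₀ < R′`, `Rs + 2 < R′`, `reach < R′`, `1 ≤ R′`. [folklore] -/
theorem T₀a_lt_RA' (κ : Consts) {V : Type} [Countable V] {G : SimpleGraph V} [G.LocallyFinite] (Φ : PlanarSkeletonFrmQuasi G) (t : V) (p : unitInterval) (D : Skelφ.StepI.DataNS V) (mk : ℕ) : T₀a t D mk < RA' κ Φ t p D mk ∧ Rs t D mk + 2 < RA' κ Φ t p D mk ∧ reachA t D mk < RA' κ Φ t p D mk ∧ 1 ≤ RA' κ Φ t p D mk := by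
  have h1 : 13 * (T₀a t D mk + 1) ≤ reachA t D mk := by unfold reachA; omega
  have h2 := (le_T₀a t D mk).2.1
  unfold RA' RlevA; omega

end Counts

end KS

end NegB

end PlanarSkeletonFrmQuasi

end Summit.CriticalPhenomena.PercolationContinuityZ3.Theorems.Transplant

end
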